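import Literature.NumberTheory.Rogawski1990.ArchTransfFamilyWallBracket      -- (GLUE-X-dress) B2: `exists_nhds_contDiffOn_bracket` (+ B1 wall geometry)
import Literature.NumberTheory.Rogawski1990.ArchTransfFamilyResolved         -- ★ p850171 LH3-p04 (g3): `transfFamReg_eq_unit_mul_sum`, `contDiff_unit`, `exists_continuousLinearEquiv_eq_slotPerm`, `continuous_slotPerm`; brings ★ A1 `sum_kappaSign_slotPerm_eq_half_sum_pairs`, ★ `dense_regG`, ★ `archBzPeriodic_transfFam`
import HarnessLib

/-!
# (GLUE-X-dress) FILE B3 — `transfFam L α μ F S` is `C^∞` across the `H`-regular `G`-walls: the head `contDiffOn_transfFam_nhds_of_hcSemireg`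
# (Rogawski 1990 §4.3 (4.3.1) p. 43, Prop. 4.9.1 (a) p. 55; Shelstad 1979 Thm. 4.7 p. 31; Bouaziz 1994 §3.2, Rem. 2 p. 594)

Topic `NumberTheory/Rogawski1990`; namespace `Literature.NumberTheory.Rogawski1990`.  THEOREMS ONLY (no `def`, no instance, no notation, no axiom, no named fact, no `sorry`).
Cell `pub/hodgecm-mathlib`, crux H413 (`stmt-HodgeConjecture-24833`), F0∕P3c line LH3 (closer stub `stub_N9`, DIRECT ROAD «Transf», organ O-L2 `stub_N9transf`); brick
**(GLUE-X-dress)** (LH3-plan (g2) 2026-09-02T06:35:47Z; head signature «=» 06:40:57Z), FILE B3 = THE HEAD; seat F0P3a-p09 (g5).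

THE HEAD (`contDiffOn_transfFam_nhds_of_hcSemireg`).  House frame (`α_i ≠ 0`, `σ_w α_i` real), `μ`-guard, admissible `H`-chart `S ⊆ splitChartPlaces L α`, `F` in Harish-Chandra's space
★ `ArchHCSpaceG (slotSign L α) jc′ F`.  At a point `p` of the `H`-chart which lies on ONE `G`-wall at a compact place `w ∉ S` — `p w 1 = p w a`, `a ∈ {0, 2}` (the `H`-central line
`e^{ic_{w1}}` collides with one of the 2-block lines), the `H`-root regular there (`e^{ic_{w0}} ≠ e^{ic_{w2}}`), every other compact place regular, `x ≠ 0` at the split places —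
the candidate transfer family member ★ `transfFam L α μ F S = bzExtendG S (transfFamReg …)` is `C^∞` on a neighbourhood of `p`.  Rider `…_of_circleExp_eq`: the same at the
`2π`-translates `e^{ip_{w1}} = e^{ip_{wa}}` (★ (P) `archBzPeriodic_transfFam`).
PROOF (Shelstad's Thm. 4.7 in coordinates).  On the dense open `RegG S`, ★ `transfFamReg_eq_unit_mul_sum` (LH3-p04 (g3), over ★ A1) writes the member as
`w_S·Ũ_k(c)·Σ_ρ (K_ρσ_ρ)·'F(ρ·c)` with an ENTIRE unit `Ũ_k` and `'F = archERhoG S · F S`; ★ A1 `sum_kappaSign_slotPerm_eq_half_sum_pairs` regroups the partner sum in mirror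
pairs `ρ ↔ (1 a)∘ρ`: `Σ_ρ (Kσ)_ρ 'F(ρ·c) = ½ Σ_ρ (Kσ)_ρ ('F(ρ·c) − ε_ρ 'F(s_ρ(ρ·c)))`, `s_ρ` the swap of the slots `ρ_w⁻¹1, ρ_w⁻¹a` at `w`, `ε_ρ` the product of their slot signs;
B2 `exists_nhds_contDiffOn_bracket` makes each bracket a function `N_ρ` smooth on a neighbourhood `U_ρ` of `ρ·p` (semiregular by B1 `hcSemireg_slotPerm`); so on
`V = V₀ ∩ ⋂_ρ (ρ·)⁻¹U_ρ` the member agrees on `RegG S` with the smooth `G = w_S·Ũ_k·½Σ_ρ (Kσ)_ρ·N_ρ(ρ·c)`, and at the remaining points of `V` (all inside `InRegS S`) the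
`extendFrom` value is the limit of `G` (★ `dense_regG`), i.e. `transfFam = G` on `V`.
HONEST LABEL: HC_CM is proved only modulo the 7 printed citations (2 remaining named inputs: hLiu418 = `stmt-HodgeConjecture-24832`, h413 = `stmt-HodgeConjecture-24833`) until rung 0
closes; this head is count-neutral calculus under O-L2 (it is the «across-the-`G`-wall» clause of (SB-TRANSF)∕(M2) for LH3-p04 (g3)'s assembly), pays no organ by itself.

## References
* [Rogawski1990] J. D. Rogawski, *Automorphic Representations of Unitary Groups in Three Variables*, Ann. of Math. Stud. 123 (1990), §4.3 (4.3.1) p. 43, Prop. 4.9.1 (a) p. 55,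
  §14.3 pp. 233–234.
* [Shelstad1979] D. Shelstad, *Characters and inner forms of a quasi-split group over ℝ*, Compositio Math. 39 (1979) 11–45, Thm. 4.7 (p. 31), Lemma 4.2 (p. 23).
* [Bouaziz1994IntegralesOrbitales] A. Bouaziz, *Intégrales orbitales sur les algèbres de Lie réductives*, Invent. Math. 115 (1994), §3.2 (I₁)–(I₃) pp. 579–580, Rem. 2 p. 594.
-/

open Function Set Filter Topology Finset Complex NumberField NumberField.InfinitePlace
open scoped ContDiff Classical
open Literature.NumberTheory.Automorphic Literature.NumberTheory.Automorphic.UnitaryGroup Literature.NumberTheory.Automorphic.ArchCartan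
open Literature.NumberTheory.GaloisRepresentations

namespace Literature.NumberTheory.Rogawski1990

section Head

variable (L : Type) [Field L] [NumberField L] [IsCMField L] (α : Fin 3 → L) (μ : HeckeCharacter L)

omit [NumberField L] [IsCMField L] in
/-- `slotSign` in the printed shape of ★ A1's pairing coefficient. [cite: Rogawski1990, §3.6 p. 31] -/
theorem slotSign_eq_sign_re (w : {w : InfinitePlace L // IsComplex w}) (k : Fin 3) :
    slotSign L α w k = SignType.sign ((w.1.embedding (α (lineOf (formSign L α w) k))).re) := rfl

omit [NumberField L] [IsCMField L] in
/-- The pair `(1, a)`, `a ∈ {0, 2}`, at a point with `p w 1 = p w a` and `e^{ip_{w0}} ≠ e^{ip_{w2}}` is a semiregular wall datum. [cite: Shelstad1979, §4 p. 22] -/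
theorem hcSemireg_one_of_pair {S : Finset {w : InfinitePlace L // IsComplex w}} {w : {w : InfinitePlace L // IsComplex w}} {a : Fin 3} (ha : a = 0 ∨ a = 2)
    {p : {w : InfinitePlace L // IsComplex w} → Fin 3 → ℝ} (hp : p w 1 = p w a) (hH : Circle.exp (p w 0) ≠ Circle.exp (p w 2))
    (hreg : ∀ w', w' ∉ S → w' ≠ w → Function.Injective fun l : Fin 3 => Circle.exp (p w' l)) (hx : ∀ w' ∈ S, p w' 0 ≠ 0) : HcSemireg S w 1 a p := by
  refine ⟨hp, ?_, hreg, hx⟩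
  rcases ha with rfl | rfl
  · rw [hcThird_comm, hcThird_zero_one, hp]; exact hH.symm
  · rw [hcThird_one_two, hp]; exact hH

/-- **`transfFam L α μ F S` IS `C^∞` ACROSS THE `H`-REGULAR `G`-WALLS (the head of (GLUE-X-dress)).**  House frame, `μ`-guard, admissible chart `S ⊆ splitChartPlaces L α`,
`F ∈ ArchHCSpaceG (slotSign L α) jc′`; at `p` with `p w 1 = p w a` (`w ∉ S` compact, `a ∈ {0,2}`), `e^{ip_{w0}} ≠ e^{ip_{w2}}`, every other compact place regular and `x ≠ 0` at
the split places, there is an open `U ∋ p` with `ContDiffOn ℝ ∞ (transfFam L α μ F S) U`.  (The κ-signature flips across exactly the walls where `F S` jumps; the paired brackets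
are smooth by B2; their sum with the entire unit prefactor is the member on the dense `RegG S` and its `extendFrom` elsewhere.) [cite: Shelstad1979, Thm. 4.7 (p. 31)]
[cite: Rogawski1990, §4.3 (4.3.1) p. 43; Prop. 4.9.1 (a) p. 55] [cite: Bouaziz1994IntegralesOrbitales, §3.2 (I₁)–(I₃) pp. 579–580; Rem. 2 p. 594] -/
theorem contDiffOn_transfFam_nhds_of_hcSemireg (hα : ∀ i, α i ≠ 0) (hreal : ∀ (w : {w : InfinitePlace L // IsComplex w}) (i : Fin 3), (w.1.embedding (α i)).im = 0)
    (hμω : ∀ x : ideleGroup ↥(maximalRealSubfield L), μ (AdeleRing.ideleBaseChange (↥(maximalRealSubfield L)) L x) = quadraticHeckeCharCM L x)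
    {S : Finset {w : InfinitePlace L // IsComplex w}} (hS : ∀ w ∈ S, w ∈ splitChartPlaces L α)
    {jc' : Finset {w : InfinitePlace L // IsComplex w} → {w : InfinitePlace L // IsComplex w} → Fin 3 → Fin 3 → ℂ}
    {F : Finset {w : InfinitePlace L // IsComplex w} → ({w : InfinitePlace L // IsComplex w} → Fin 3 → ℝ) → ℂ} (hF : ArchHCSpaceG (slotSign L α) jc' F)
    {w : {w : InfinitePlace L // IsComplex w}} (hw : w ∉ S) {a : Fin 3} (ha : a = 0 ∨ a = 2) {p : {w : InfinitePlace L // IsComplex w} → Fin 3 → ℝ} (hp : p w 1 = p w a)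
    (hH : Circle.exp (p w 0) ≠ Circle.exp (p w 2)) (hreg : ∀ w', w' ∉ S → w' ≠ w → Function.Injective fun l : Fin 3 => Circle.exp (p w' l))
    (hx : ∀ w' ∈ S, p w' 0 ≠ 0) :
    ∃ U ∈ 𝓝 p, IsOpen U ∧ ContDiffOn ℝ ∞ (transfFam L α μ F S) U := by
  classical
  have h1a : (1 : Fin 3) ≠ a := by rcases ha with rfl | rfl <;> decide
  have hps : HcSemireg S w 1 a p := hcSemireg_one_of_pair L ha hp hH hreg hx
  have hsgn : ∀ k : Fin 3, slotSign L α w k ≠ 0 := fun k => by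
    rw [slotSign_eq_sign_re, Ne, sign_eq_zero_iff]
    exact re_embedding_ne_zero_of_real L α (hα _) w (hreal w _)
  -- the resolved prefactor `w_S·Ũ_k` (★ LH3-p04): an entire function `Pf` with `transfFamReg = Pf · Σ_ρ (Kσ)_ρ·'F(ρ·c)` on `RegG S`
  obtain ⟨k, hk⟩ := exists_archTau_mul_archWeylRatio_endoTorus_eq L μ hμω
  obtain ⟨Pf, hPfeq, hPf⟩ : ∃ Pf : ({w : InfinitePlace L // IsComplex w} → Fin 3 → ℝ) → ℂ,
      (∀ c : {w : InfinitePlace L // IsComplex w} → Fin 3 → ℝ, c ∈ RegG S → transfFamReg L α μ F S c =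
        Pf c * ∑ ρ ∈ partnerPerms S,
          (((∏ w : {w : InfinitePlace L // IsComplex w},
              ((SignType.sign ((w.1.embedding (α (lineOf (formSign L α w) ((ρ w).symm 1)))).re) : ℤ) * archMajoritySign L (Matrix.diagonal α) w) : ℤ) : ℂ) *
            ∏ w : {w : InfinitePlace L // IsComplex w}, (Equiv.Perm.sign (ρ w) : ℂ)) *
          (archERhoG S (slotPerm ρ c) * F S (slotPerm ρ c))) ∧ ContDiff ℝ ∞ Pf :=
    ⟨_, fun c hc => transfFamReg_eq_unit_mul_sum L α μ hS F k (hk S) hc, contDiff_const.mul (contDiff_unit S k)⟩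
  -- the brackets, one per partner label
  have hbr : ∀ ρ ∈ partnerPerms S, ∃ U ∈ 𝓝 (slotPerm ρ p), IsOpen U ∧ ∃ N : ({w : InfinitePlace L // IsComplex w} → Fin 3 → ℝ) → ℂ, ContDiffOn ℝ ∞ N U ∧
      ∀ q ∈ U, q w ((ρ w).symm 1) ≠ q w ((ρ w).symm a) →
        N q = archERhoG S q * F S q - ((((slotSign L α w ((ρ w).symm 1) : ℤ) * (slotSign L α w ((ρ w).symm a) : ℤ)) : ℤ) : ℂ) *
          (archERhoG S (hcSwapAt w ((ρ w).symm 1) ((ρ w).symm a) q) * F S (hcSwapAt w ((ρ w).symm 1) ((ρ w).symm a) q)) :=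
    fun ρ hρ => exists_nhds_contDiffOn_bracket hF hw (fun h => h1a ((ρ w).symm.injective h)) (hsgn _) (hsgn _) (hcSemireg_slotPerm hρ h1a hps)
  choose! U hUn hUo N hN hNeq using hbr
  -- the `c`-side neighbourhood
  obtain ⟨V₀, hV₀o, hpV₀, -, hV1, hV2, hV3, hV4⟩ := exists_nhds_hcSemireg hw h1a hps
  set V : Set ({w : InfinitePlace L // IsComplex w} → Fin 3 → ℝ) := V₀ ∩ {c | ∀ ρ ∈ partnerPerms S, slotPerm ρ c ∈ U ρ} with hVdef
  have hVo : IsOpen V := by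
    have h : {c : {w : InfinitePlace L // IsComplex w} → Fin 3 → ℝ | ∀ ρ ∈ partnerPerms S, slotPerm ρ c ∈ U ρ} = ⋂ ρ ∈ partnerPerms S, slotPerm ρ ⁻¹' U ρ := by
      ext c; simp only [Set.mem_setOf_eq, Set.mem_iInter, Set.mem_preimage]
    rw [hVdef, h]
    exact hV₀o.inter (isOpen_biInter_finset fun ρ hρ => (hUo ρ hρ).preimage (continuous_slotPerm ρ))
  have hpV : p ∈ V := ⟨hpV₀, fun ρ hρ => mem_of_mem_nhds (hUn ρ hρ)⟩
  have hVS : V ⊆ InRegS S := fun c hc => regS_subset_inRegS S (mem_regS_of_pair_one ha (hV2 c hc.1) (hV3 c hc.1) (hV4 c hc.1))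
  -- the smooth representative `G = Pf·½Σ_ρ (Kσ)_ρ·N_ρ(ρ·c)`
  have hG : ContDiffOn ℝ ∞ (fun c : {w : InfinitePlace L // IsComplex w} → Fin 3 → ℝ =>
      Pf c * ((1 / 2 : ℂ) * ∑ ρ ∈ partnerPerms S,
        (((∏ w : {w : InfinitePlace L // IsComplex w},
            ((SignType.sign ((w.1.embedding (α (lineOf (formSign L α w) ((ρ w).symm 1)))).re) : ℤ) * archMajoritySign L (Matrix.diagonal α) w) : ℤ) : ℂ) *
          ∏ w : {w : InfinitePlace L // IsComplex w}, (Equiv.Perm.sign (ρ w) : ℂ)) * N ρ (slotPerm ρ c))) V := by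
    refine hPf.contDiffOn.mul (contDiffOn_const.mul (ContDiffOn.sum fun ρ hρ => contDiffOn_const.mul ?_))
    obtain ⟨P, hP⟩ := exists_continuousLinearEquiv_eq_slotPerm ρ
    have hcomp : (fun c : {w : InfinitePlace L // IsComplex w} → Fin 3 → ℝ => N ρ (slotPerm ρ c)) = N ρ ∘ P := by
      funext c; rw [Function.comp_apply, hP]
    rw [hcomp]
    exact (hN ρ hρ).comp P.contDiff.contDiffOn fun c hc => by rw [hP]; exact hc.2 ρ hρ
  -- on `RegG S ∩ V` the member IS `G`
  have key : ∀ c ∈ V, c ∈ RegG S → transfFamReg L α μ F S c =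
      Pf c * ((1 / 2 : ℂ) * ∑ ρ ∈ partnerPerms S,
        (((∏ w : {w : InfinitePlace L // IsComplex w},
            ((SignType.sign ((w.1.embedding (α (lineOf (formSign L α w) ((ρ w).symm 1)))).re) : ℤ) * archMajoritySign L (Matrix.diagonal α) w) : ℤ) : ℂ) *
          ∏ w : {w : InfinitePlace L // IsComplex w}, (Equiv.Perm.sign (ρ w) : ℂ)) * N ρ (slotPerm ρ c)) := by
    intro c hcV hcR
    rw [hPfeq c hcR]
    refine congrArg (HMul.hMul (Pf c)) ?_
    have h5 := sum_kappaSign_slotPerm_eq_half_sum_pairs L α hα (hreal w) hw h1a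
      (fun q : {w : InfinitePlace L // IsComplex w} → Fin 3 → ℝ => archERhoG S q * F S q) c
    beta_reduce at h5
    rw [h5]
    refine congrArg (HMul.hMul (1 / 2 : ℂ)) (Finset.sum_congr rfl fun ρ hρ => congrArg (HMul.hMul _) ?_)
    have hmem : slotPerm ρ c ∈ U ρ := hcV.2 ρ hρ
    have hne : slotPerm ρ c w ((ρ w).symm 1) ≠ slotPerm ρ c w ((ρ w).symm a) := by
      rw [slotPerm_apply_symm, slotPerm_apply_symm]; exact apply_ne_apply_of_mem_regG hcR hw h1a
    rw [hNeq ρ hρ (slotPerm ρ c) hmem hne, Equiv.swap_apply_left, Int.cast_mul, Int.cast_mul,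
      mul_comm ((slotSign L α w ((ρ w).symm 1) : ℤ) : ℂ)]
    rfl
  -- `transfFam = G` on `V`
  refine ⟨V, hVo.mem_nhds hpV, hVo, hG.congr fun c hc => ?_⟩
  by_cases hcR : c ∈ RegG S
  · rw [transfFam_of_mem_regG L α μ F S hcR]
    exact key c hc hcR
  · rw [transfFam_of_mem_inRegS_of_not_mem_regG L α μ F S (hVS hc) hcR]
    refine extendFrom_eq (by rw [(dense_regG S).closure_eq]; exact Set.mem_univ c) ?_
    refine (((hG.continuousOn c hc).continuousAt (hVo.mem_nhds hc)).tendsto.mono_left nhdsWithin_le_nhds).congr' ?_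
    filter_upwards [self_mem_nhdsWithin, mem_nhdsWithin_of_mem_nhds (hVo.mem_nhds hc)] with y hyR hyV
    exact (key y hyV hyR).symm

/-- **RIDER — the same across every `2π`-translate of the wall**: the hypothesis `p w 1 = p w a` may be weakened to `e^{ip_{w1}} = e^{ip_{wa}}` ((P) ★ `archBzPeriodic_transfFam`:
`transfFam … S (c + angleShift w 1 m) = transfFam … S c`). [cite: Shelstad1979, §4 p. 22; Thm. 4.7 (p. 31)] [cite: Rogawski1990, §4.3 (4.3.1) p. 43] -/
theorem contDiffOn_transfFam_nhds_of_circleExp_eq (hα : ∀ i, α i ≠ 0) (hreal : ∀ (w : {w : InfinitePlace L // IsComplex w}) (i : Fin 3), (w.1.embedding (α i)).im = 0)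
    (hμω : ∀ x : ideleGroup ↥(maximalRealSubfield L), μ (AdeleRing.ideleBaseChange (↥(maximalRealSubfield L)) L x) = quadraticHeckeCharCM L x)
    {S : Finset {w : InfinitePlace L // IsComplex w}} (hS : ∀ w ∈ S, w ∈ splitChartPlaces L α)
    {jc' : Finset {w : InfinitePlace L // IsComplex w} → {w : InfinitePlace L // IsComplex w} → Fin 3 → Fin 3 → ℂ}
    {F : Finset {w : InfinitePlace L // IsComplex w} → ({w : InfinitePlace L // IsComplex w} → Fin 3 → ℝ) → ℂ} (hF : ArchHCSpaceG (slotSign L α) jc' F)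
    {w : {w : InfinitePlace L // IsComplex w}} (hw : w ∉ S) {a : Fin 3} (ha : a = 0 ∨ a = 2) {p : {w : InfinitePlace L // IsComplex w} → Fin 3 → ℝ}
    (hp : Circle.exp (p w 1) = Circle.exp (p w a))
    (hH : Circle.exp (p w 0) ≠ Circle.exp (p w 2)) (hreg : ∀ w', w' ∉ S → w' ≠ w → Function.Injective fun l : Fin 3 => Circle.exp (p w' l))
    (hx : ∀ w' ∈ S, p w' 0 ≠ 0) :
    ∃ U ∈ 𝓝 p, IsOpen U ∧ ContDiffOn ℝ ∞ (transfFam L α μ F S) U := by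
  classical
  have h1a : (1 : Fin 3) ≠ a := by rcases ha with rfl | rfl <;> decide
  obtain ⟨m, hm⟩ := Circle.exp_eq_exp.1 hp
  -- translate the slot `(w, 1)` by `-2πm`
  set p' : {w : InfinitePlace L // IsComplex w} → Fin 3 → ℝ := p + angleShift w 1 (-m) with hp'def
  have hsh : ∀ (c : {w : InfinitePlace L // IsComplex w} → Fin 3 → ℝ) (w' : {w : InfinitePlace L // IsComplex w}) (l : Fin 3),
      (c + angleShift w 1 (-m)) w' l = if w' = w ∧ l = 1 then c w 1 + 2 * Real.pi * (-m : ℤ) else c w' l := by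
    intro c w' l
    rw [Pi.add_apply, Pi.add_apply, angleShift]
    by_cases hw' : w' = w
    · subst hw'
      rw [Pi.single_eq_same]
      by_cases hl : l = 1
      · subst hl; rw [Pi.single_eq_same, if_pos ⟨rfl, rfl⟩]
      · rw [Pi.single_eq_of_ne hl, if_neg (fun h => hl h.2), add_zero]
    · rw [Pi.single_eq_of_ne hw', Pi.zero_apply, add_zero, if_neg (fun h => hw' h.1)]
  have hp'1 : p' w 1 = p' w a := by
    rw [hp'def, hsh, hsh, if_pos ⟨rfl, rfl⟩, if_neg (fun h => h1a h.2.symm), hm]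
    push_cast; ring
  have hp'w : ∀ l, l ≠ 1 → p' w l = p w l := fun l hl => by rw [hp'def, hsh, if_neg (fun h => hl h.2)]
  have hp'o : ∀ w', w' ≠ w → p' w' = p w' := fun w' hw' => by funext l; rw [hp'def, hsh, if_neg (fun h => hw' h.1)]
  have hH' : Circle.exp (p' w 0) ≠ Circle.exp (p' w 2) := by rw [hp'w 0 (by decide), hp'w 2 (by decide)]; exact hH
  have hreg' : ∀ w', w' ∉ S → w' ≠ w → Function.Injective fun l : Fin 3 => Circle.exp (p' w' l) := fun w' hw' hne => by
    rw [hp'o w' hne]; exact hreg w' hw' hne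
  have hx' : ∀ w' ∈ S, p' w' 0 ≠ 0 := fun w' hw' => by
    rw [hp'o w' (fun h => hw (h ▸ hw'))]; exact hx w' hw'
  obtain ⟨U', hU'n, hU'o, hU's⟩ := contDiffOn_transfFam_nhds_of_hcSemireg L α μ hα hreal hμω hS hF hw ha hp'1 hH' hreg' hx'
  -- pull back along the translation
  have hT : Continuous fun c : {w : InfinitePlace L // IsComplex w} → Fin 3 → ℝ => c + angleShift w 1 (-m) := by fun_prop
  refine ⟨(fun c => c + angleShift w 1 (-m)) ⁻¹' U', hT.continuousAt.preimage_mem_nhds (by exact hU'n), hU'o.preimage hT, ?_⟩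
  have hper : ∀ c : {w : InfinitePlace L // IsComplex w} → Fin 3 → ℝ, transfFam L α μ F S c = transfFam L α μ F S (c + angleShift w 1 (-m)) :=
    fun c => (archBzPeriodic_transfFam L α μ F hF.1 S c w 1 (-m) (Or.inl hw)).symm
  have hcomp : transfFam L α μ F S = transfFam L α μ F S ∘ fun c => c + angleShift w 1 (-m) := funext hper
  rw [hcomp]
  exact hU's.comp ((contDiff_id.add contDiff_const).contDiffOn) fun c hc => hc

/-- **COROLLARY IN THE BINDER SHAPE OF LH3-p04 (g3)'s (SB-TRANSF) assembly hypothesis `hwall`** (★ `ArchTransfFamilySmoothInRegS`, p850233): at every point of `InRegS S` on a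
`G`-wall `e^{iq_{w1}} = e^{iq_{wt}}` (`t ≠ 1`) of a compact place `w ∉ S`, regular at the other compact places and with `x ≠ 0` at the split places, `transfFam … S` is `C^∞`
nearby.  (The indefiniteness hypothesis is not used: at a definite place the statement is the tame case and also follows from the rider.) [cite: Shelstad1979, Thm. 4.7 (p. 31)]
[cite: Rogawski1990, §4.3 (4.3.1) p. 43; Prop. 4.9.1 (a) p. 55] [cite: Bouaziz1994IntegralesOrbitales, Rem. 2 p. 594] -/
theorem contDiffOn_transfFam_nhds_wall (hα : ∀ i, α i ≠ 0) (hreal : ∀ (w : {w : InfinitePlace L // IsComplex w}) (i : Fin 3), (w.1.embedding (α i)).im = 0)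
    (hμω : ∀ x : ideleGroup ↥(maximalRealSubfield L), μ (AdeleRing.ideleBaseChange (↥(maximalRealSubfield L)) L x) = quadraticHeckeCharCM L x)
    {jc' : Finset {w : InfinitePlace L // IsComplex w} → {w : InfinitePlace L // IsComplex w} → Fin 3 → Fin 3 → ℂ}
    {F : Finset {w : InfinitePlace L // IsComplex w} → ({w : InfinitePlace L // IsComplex w} → Fin 3 → ℝ) → ℂ} (hF : ArchHCSpaceG (slotSign L α) jc' F) :
    ∀ S : Finset {w : InfinitePlace L // IsComplex w}, (∀ w ∈ S, w ∈ splitChartPlaces L α) →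
      ∀ w ∉ S, IsIndefiniteAt (slotSign L α) w → ∀ t : Fin 3, t ≠ 1 →
        ∀ q ∈ InRegS S, Circle.exp (q w 1) = Circle.exp (q w t) →
          (∀ w' ∉ S, w' ≠ w → Function.Injective fun l : Fin 3 => Circle.exp (q w' l)) → (∀ w' ∈ S, q w' 0 ≠ 0) →
            ∃ V ∈ 𝓝 q, ContDiffOn ℝ ∞ (transfFam L α μ F S) V := by
  intro S hS w hw _ t ht q hq hqt hreg hx
  have ha : t = 0 ∨ t = 2 := by
    revert ht; fin_cases t <;> decide
  obtain ⟨U, hU, -, hUs⟩ := contDiffOn_transfFam_nhds_of_circleExp_eq L α μ hα hreal hμω hS hF hw ha hqt (hq w hw) hreg hx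
  exact ⟨U, hU, hUs⟩

end Head

end Literature.NumberTheory.Rogawski1990
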